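import Summits.ValiantsHypothesis.ValiantsHypothesis.Theorems.BarrierLeverAnchoredDoorHitsLowerPairsDAResidual
import Summits.ValiantsHypothesis.ValiantsHypothesis.Theorems.BarrierLeverAnchoredDoorHitsLowerPairsEvalCompressed

/-!
# Support item `AnchoredDoorHitsLowerPairs` (stmt-ValiantsHypothesis-22510), line `anchored_peeling`:
# THE REGISTERED RESIDUAL MINUS COMPRESSED AND FROBENIUS-CERTIFIED PAIRS — the classes `EvalGP.IsCompressed`, `EvalGP.IsFrobCert`,
# the narrowed node `Stmt.stub_ltRestNonCanonRSWPDF`, and the kernel glue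

Helper file (`--supports stmt-ValiantsHypothesis-22510`; cell valiant-natproofs, rung V4; prover seat val-np-p1 gen 30; memo
HOME/val-np-p1/g30/MEMO-char2-valnp1-g30.md §7). Closes NO item.

WHY. The registered concluding node of line v29/v30 is `Stmt.stub_ltRestNonCanonRSWPD` (planner R44, val-np-p1 g27 `…DAResidual`): the residual of
lower pairs outside every landed kernel class and outside the distinct-anchor (Hall) regime. Its docstring names as the ONLY candidate members «deep × wide
lower pairs, e.g. cube_n against a 2-dimensional column complex, n ≳ 28». Those candidates are DEAD at every profile `s ≥ 1`: a full cube — more generally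
every COMPRESSED family (an initial segment of the binary/colex order: an injective labelling `e` of the vertices with all binary codes `Σ_{b ∈ U} 2^{e b} < r`)
— against ANY injective lower family of the same size carries a member of 𝔄_s with nonzero partition minor, by the Frobenius–Vandermonde argument mod 2
(val-np-p1 g30, p724260 `EvalGP.symbolicDet_ne_zero_of_compressed`; p723181 for cubes), and more generally so does every pair whose mod-2 generalised
Vandermonde `det ((Σ_{γ ∈ w j} X_γ)^{Σ_{b ∈ u i} 2^{e b}})_{i j} ∈ 𝔽₂[X]` is nonzero for SOME labelling `e` (p725402 `EvalGP.symbolicDet_ne_zero_of_frob_det_ne_zero`).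

CONTENTS. §1 the two classes as `Prop`s with their certificates (both orientations, every profile `s ≥ 1`) and `isFrobCert_of_isCompressed`;
§2 `Stmt.stub_ltRestNonCanonRSWPDF` = the v29 text VERBATIM with four more exclusions (not compressed on either side, no Frobenius certificate in
either orientation) and the UNCONDITIONAL glue `stub_ltRestNonCanonRSWPD_of_rswpdf` (a 1:1 weakest-node narrowing candidate: the excluded classes are hit
by landed theorems), with the composition BY NAME `anchoredDoorHitsLowerPairs_of_ltRestNonCanonRSWPDF`.

MEMBERS of the narrowed residual must now have a NON-compressed deep part on both sides (e.g. a Hamming ball `B(n, k)` or a cube plus generic junk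
against a wide 2-dimensional complex, `n ≳ 30`, with the mod-2 Schur factor of the generalised Vandermonde vanishing for every labelling); no explicit
member is known. WHAT THIS IS NOT: nothing on crux stmt-ValiantsHypothesis-14610 or on `VP ≠ VNP`.
-/

set_option linter.dupNamespace false

namespace Summit.ValiantsHypothesis.ValiantsHypothesis.Theorems.BarrierLever.AnchoredPeeling

open Finset MvPolynomial

noncomputable section

/-! ## 1. Compressed families and Frobenius certificates -/

namespace EvalGP

variable {h r : ℕ}

/-- **`IsCompressed u`: the family `u` is COMPRESSED** — some injective labelling `e` of the vertices gives every member a binary code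
`Σ_{b ∈ u i} 2^{e b} < r` (so the `r` codes are exactly `0, …, r − 1`: an initial segment of the colex order; full cubes are compressed). -/
def IsCompressed (u : Fin r → Finset (Fin h)) : Prop :=
  ∃ e : Fin h → ℕ, Function.Injective e ∧ ∀ i, ∑ b ∈ u i, 2 ^ e b < r

/-- **`IsFrobCert u w`: the pair has a FROBENIUS CERTIFICATE** — for some labelling `e` of the row vertices the mod-2 generalised Vandermonde
`((Σ_{γ ∈ w j} X_γ) ^ (Σ_{b ∈ u i} 2^{e b}))_{i j}` over `𝔽₂[X]` has nonzero determinant. -/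
def IsFrobCert (u w : Fin r → Finset (Fin h)) : Prop :=
  ∃ e : Fin h → ℕ, (Matrix.of fun i j : Fin r =>
    (∑ γ ∈ w j, (X γ : MvPolynomial (Fin h) (ZMod 2))) ^ (∑ b ∈ u i, 2 ^ e b)).det ≠ 0

/-- A compressed row family against any injective column family has a Frobenius certificate (Frobenius–Vandermonde mod 2). -/
theorem isFrobCert_of_isCompressed (u w : Fin r → Finset (Fin h)) (hu : Function.Injective u) (hw : Function.Injective w)
    (H : IsCompressed u) : IsFrobCert u w := by
  obtain ⟨e, he, hlt⟩ := H
  refine ⟨e, ?_⟩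
  have hM : (Matrix.of fun i j : Fin r => (∑ γ ∈ w j, (X γ : MvPolynomial (Fin h) (ZMod 2))) ^ (∑ b ∈ u i, 2 ^ e b)) =
      (Matrix.of fun i j : Fin r => ∏ b ∈ u i, ∑ γ ∈ w j, (X γ : MvPolynomial (Fin h) (ZMod 2)) ^ 2 ^ e b) := by
    ext i j
    rw [Matrix.of_apply, Matrix.of_apply, frobEntry_charTwo]
  rw [hM]
  exact det_frob_zmod2_ne_zero_of_compressed u w hu hw e he hlt

/-- **Compressed rows are hit at every profile `s ≥ 1`** (against any injective lower column family of the same size). -/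
theorem symbolicDet_ne_zero_of_isCompressed {s : ℕ} (hs : 1 ≤ s) (u w : Fin r → Finset (Fin h)) (hu : Function.Injective u)
    (hw : Function.Injective w) (hlw : IsLowerSet (Set.range w)) (H : IsCompressed u) : symbolicDet s h r u w ≠ 0 := by
  obtain ⟨e, he, hlt⟩ := H
  exact symbolicDet_ne_zero_of_compressed hs u w hu hw hlw e he hlt

/-- **Compressed columns are hit at every profile `s ≥ 1`** (against any injective lower row family of the same size). -/
theorem symbolicDet_ne_zero_of_isCompressed_swap {s : ℕ} (hs : 1 ≤ s) (u w : Fin r → Finset (Fin h)) (hu : Function.Injective u)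
    (hw : Function.Injective w) (hlu : IsLowerSet (Set.range u)) (H : IsCompressed w) : symbolicDet s h r u w ≠ 0 := by
  obtain ⟨e, he, hlt⟩ := H
  exact symbolicDet_ne_zero_of_compressed_swap hs u w hu hw hlu e he hlt

/-- **A Frobenius certificate hits the pair at every profile `s ≥ 1`** (columns injective lower). -/
theorem symbolicDet_ne_zero_of_isFrobCert {s : ℕ} (hs : 1 ≤ s) (u w : Fin r → Finset (Fin h)) (hw : Function.Injective w)
    (hlw : IsLowerSet (Set.range w)) (H : IsFrobCert u w) : symbolicDet s h r u w ≠ 0 := by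
  obtain ⟨e, hdet⟩ := H
  exact symbolicDet_ne_zero_of_frob_det_ne_zero hs u w hw hlw e hdet

/-- **A Frobenius certificate of the swapped pair hits the pair at every profile `s ≥ 1`** (rows injective lower). -/
theorem symbolicDet_ne_zero_of_isFrobCert_swap {s : ℕ} (hs : 1 ≤ s) (u w : Fin r → Finset (Fin h)) (hu : Function.Injective u)
    (hlu : IsLowerSet (Set.range u)) (H : IsFrobCert w u) : symbolicDet s h r u w ≠ 0 := by
  obtain ⟨e, hdet⟩ := H
  exact symbolicDet_ne_zero_of_frob_det_ne_zero_swap hs u w hu hlu e hdet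

/-- A full cube `{S | S ⊆ D}` (injectively enumerated) is compressed. -/
theorem isCompressed_of_cube (D : Finset (Fin h)) (u : Fin r → Finset (Fin h)) (hu : Function.Injective u)
    (hru : Set.range u = {S | S ⊆ D}) : IsCompressed u := by
  classical
  obtain ⟨e, he, hlt⟩ := exists_labelling D
  let e' : Fin h → ℕ := fun b => if b ∈ D then e b else D.card + b.val
  have he'D : ∀ b ∈ D, e' b = e b := fun b hb => by simp [e', hb]
  have he'N : ∀ b, b ∉ D → e' b = D.card + b.val := fun b hb => by simp [e', hb]
  have hinj : Function.Injective e' := by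
    intro b b' hbb
    by_cases hb : b ∈ D <;> by_cases hb' : b' ∈ D
    · rw [he'D b hb, he'D b' hb'] at hbb
      exact he (Finset.mem_coe.mpr hb) (Finset.mem_coe.mpr hb') hbb
    · rw [he'D b hb, he'N b' hb'] at hbb
      have := hlt b hb
      omega
    · rw [he'N b hb, he'D b' hb'] at hbb
      have := hlt b' hb'
      omega
    · rw [he'N b hb, he'N b' hb'] at hbb
      exact Fin.ext (by omega)
  refine ⟨e', hinj, fun i => ?_⟩
  have hsub : u i ⊆ D := by
    have hmem : u i ∈ Set.range u := ⟨i, rfl⟩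
    rw [hru] at hmem
    exact hmem
  have hsum : ∑ b ∈ u i, 2 ^ e' b = ∑ b ∈ u i, 2 ^ e b :=
    Finset.sum_congr rfl (fun b hb => by rw [he'D b (hsub hb)])
  rw [hsum, card_eq_two_pow hu hru]
  exact twoPowSum_lt he hlt hsub

end EvalGP

/-! ## 2. The registered residual minus compressed and Frobenius-certified pairs -/

/-- **STUB TEXT (offered, val-np-p1 g30): THE REGISTERED RESIDUAL MINUS COMPRESSED AND FROBENIUS-CERTIFIED PAIRS.** `Stmt.stub_ltRestNonCanonRSWPD`
(v29, planner R44) VERBATIM with four further hypotheses: the row family is not compressed, the column family is not compressed (`EvalGP.IsCompressed`),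
and the pair has no Frobenius certificate in either orientation (`EvalGP.IsFrobCert`). WEAKER than RSWPD — UNCONDITIONALLY (glue
`stub_ltRestNonCanonRSWPD_of_rswpdf`; the excluded classes are hit by p724260 / p725402): a 1:1 weakest-node narrowing candidate. It removes the only
candidate members named in the v29 docstring (cube_n against a 2-dimensional column complex). MEMBERS: deep × wide lower pairs outside the Hall regime whose
deep side is NOT an initial colex segment and whose mod-2 generalised Vandermonde has vanishing Schur factor for every labelling; none explicit.
WHY IT MIGHT FAIL: such a pair (Hamming ball `B(n,k)`, `n ≳ 30`, against a wide 2-complex?) with vanishing symbolic minor at the chosen profile. -/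
def Stmt.stub_ltRestNonCanonRSWPDF : Prop :=
  ∃ s h₀ : ℕ, 2 ≤ s ∧ ∀ h : ℕ, h₀ ≤ h → ∀ (r : ℕ) (u w : Fin r → Finset (Fin h)),
    Function.Injective u → Function.Injective w → IsLowerSet (Set.range u) → IsLowerSet (Set.range w) → 2 ≤ r →
    (∀ (a : Fin h) (W₀ : Finset (Fin h)) (𝒜 : Finset (Finset (Fin h))) (ρ : Finset (Fin h) → Finset (Fin h)), ¬ UQFData s u w a W₀ 𝒜 ρ) →
    (∀ (c : Fin h) (Z : Finset (Fin h)) (𝒜 : Finset (Finset (Fin h))) (ρ : Finset (Fin h) → Finset (Fin h)), ¬ UQFData s w u c Z 𝒜 ρ) →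
    ¬ Summit.ValiantsHypothesis.ValiantsHypothesis.Theorems.BarrierLever.AnchoredPeeling.IsRelApexPair u w → ¬ Summit.ValiantsHypothesis.ValiantsHypothesis.Theorems.BarrierLever.AnchoredPeeling.IsRelApexPair w u → ¬ Summit.ValiantsHypothesis.ValiantsHypothesis.Theorems.BarrierLever.AnchoredPeeling.LTCert u w → ¬ Summit.ValiantsHypothesis.ValiantsHypothesis.Theorems.BarrierLever.AnchoredPeeling.LTCert w u →
    (¬ ∃ (k : ℕ) (σ τ : Equiv.Perm (Fin h)), 1 ≤ k ∧ 2 * k + 1 ≤ h ∧ 2 ^ (k + 1) - 1 ≤ h ∧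
        (∀ U : Finset (Fin h), U ∈ Set.range u ↔ Summit.ValiantsHypothesis.ValiantsHypothesis.Theorems.BarrierLever.AnchoredPeeling.DecRow k h (U.map σ.toEmbedding)) ∧
        (∀ W : Finset (Fin h), W ∈ Set.range w ↔ Summit.ValiantsHypothesis.ValiantsHypothesis.Theorems.BarrierLever.AnchoredPeeling.DecCol k h (W.map τ.toEmbedding))) →
    (¬ ∃ (k : ℕ) (σ τ : Equiv.Perm (Fin h)), 1 ≤ k ∧ 2 * k + 1 ≤ h ∧ 2 ^ (k + 1) - 1 ≤ h ∧
        (∀ U : Finset (Fin h), U ∈ Set.range w ↔ Summit.ValiantsHypothesis.ValiantsHypothesis.Theorems.BarrierLever.AnchoredPeeling.DecRow k h (U.map σ.toEmbedding)) ∧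
        (∀ W : Finset (Fin h), W ∈ Set.range u ↔ Summit.ValiantsHypothesis.ValiantsHypothesis.Theorems.BarrierLever.AnchoredPeeling.DecCol k h (W.map τ.toEmbedding))) →
    (¬ ∃ (m : ℕ) (σ τ : Equiv.Perm (Fin h)), 1 ≤ m ∧ 2 * m + 2 ≤ h ∧ 2 ^ (m + 1) + 2 ^ m - 1 ≤ h ∧
        (∀ U : Finset (Fin h), U ∈ Set.range u ↔ Summit.ValiantsHypothesis.ValiantsHypothesis.Theorems.BarrierLever.AnchoredPeeling.SplitRow m h (U.map σ.toEmbedding)) ∧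
        (∀ W : Finset (Fin h), W ∈ Set.range w ↔ Summit.ValiantsHypothesis.ValiantsHypothesis.Theorems.BarrierLever.AnchoredPeeling.SplitCol m h (W.map τ.toEmbedding))) →
    (¬ ∃ (m : ℕ) (σ τ : Equiv.Perm (Fin h)), 1 ≤ m ∧ 2 * m + 2 ≤ h ∧ 2 ^ (m + 1) + 2 ^ m - 1 ≤ h ∧
        (∀ U : Finset (Fin h), U ∈ Set.range w ↔ Summit.ValiantsHypothesis.ValiantsHypothesis.Theorems.BarrierLever.AnchoredPeeling.SplitRow m h (U.map σ.toEmbedding)) ∧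
        (∀ W : Finset (Fin h), W ∈ Set.range u ↔ Summit.ValiantsHypothesis.ValiantsHypothesis.Theorems.BarrierLever.AnchoredPeeling.SplitCol m h (W.map τ.toEmbedding))) →
    ¬ _root_.Summit.ValiantsHypothesis.ValiantsHypothesis.Theorems.BarrierLever.AnchoredPeeling.IsWApexPair u w → ¬ _root_.Summit.ValiantsHypothesis.ValiantsHypothesis.Theorems.BarrierLever.AnchoredPeeling.IsWApexPair w u →
    (¬ ∃ (a c : Fin r → ℕ) (Θ : Finset (Fin h) × Finset (Fin h) → ℂ) (Φ Ψ : Finset (Fin h) × Finset (Fin h) → Fin h → ℂ),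
        (∀ i j, a i ≤ c j ∨ a i + s * (u i).card ≤ (w j).card + c j) ∧
        (Matrix.of fun i j : Fin r => if c j ≤ a i then _root_.Summit.ValiantsHypothesis.ValiantsHypothesis.Theorems.BarrierLever.AnchoredPeeling.PT.ptEntry s (a i - c j) Θ Φ Ψ (w j) (u i) else 0).det ≠ 0) →
    (¬ ∃ (a c : Fin r → ℕ) (Θ : Finset (Fin h) × Finset (Fin h) → ℂ) (Φ Ψ : Finset (Fin h) × Finset (Fin h) → Fin h → ℂ),
        (∀ i j, a i ≤ c j ∨ a i + s * (w i).card ≤ (u j).card + c j) ∧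
        (Matrix.of fun i j : Fin r => if c j ≤ a i then _root_.Summit.ValiantsHypothesis.ValiantsHypothesis.Theorems.BarrierLever.AnchoredPeeling.PT.ptEntry s (a i - c j) Θ Φ Ψ (u j) (w i) else 0).det ≠ 0) →
    ¬ _root_.Summit.ValiantsHypothesis.ValiantsHypothesis.Theorems.BarrierLever.AnchoredPeeling.XElim.IsXCertPair u w → ¬ _root_.Summit.ValiantsHypothesis.ValiantsHypothesis.Theorems.BarrierLever.AnchoredPeeling.XElim.IsXCertPair w u →
    ¬ DistinctAnchors.IsDAPair s u w → ¬ DistinctAnchors.IsDAPair s w u →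
    ¬ EvalGP.IsCompressed u → ¬ EvalGP.IsCompressed w → ¬ EvalGP.IsFrobCert u w → ¬ EvalGP.IsFrobCert w u →
    symbolicDet s h r u w ≠ 0

/-- **Kernel glue (UNCONDITIONAL; weakest-node narrowing candidate): the residual minus compressed / Frobenius-certified pairs ⟹ the v29 node.** -/
theorem stub_ltRestNonCanonRSWPD_of_rswpdf (hR : Stmt.stub_ltRestNonCanonRSWPDF) : Stmt.stub_ltRestNonCanonRSWPD := by
  obtain ⟨s, h₀, hs, H⟩ := hR
  refine ⟨s, h₀, hs, ?_⟩
  intro h hh r u w hu hw hlu hlw hr h₁ h₂ h₃ h₄ h₅ h₆ h₇ h₈ h₉ h₁₀ h₁₁ h₁₂ hP hP' hX hX' hD hD'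
  have hs1 : 1 ≤ s := le_trans (by norm_num) hs
  by_cases hC : EvalGP.IsCompressed u
  · exact EvalGP.symbolicDet_ne_zero_of_isCompressed hs1 u w hu hw hlw hC
  by_cases hC' : EvalGP.IsCompressed w
  · exact EvalGP.symbolicDet_ne_zero_of_isCompressed_swap hs1 u w hu hw hlu hC'
  by_cases hF : EvalGP.IsFrobCert u w
  · exact EvalGP.symbolicDet_ne_zero_of_isFrobCert hs1 u w hw hlw hF
  by_cases hF' : EvalGP.IsFrobCert w u
  · exact EvalGP.symbolicDet_ne_zero_of_isFrobCert_swap hs1 u w hu hlu hF'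
  exact H h hh r u w hu hw hlu hlw hr h₁ h₂ h₃ h₄ h₅ h₆ h₇ h₈ h₉ h₁₀ h₁₁ h₁₂ hP hP' hX hX' hD hD' hC hC' hF hF'

/-- **Composition BY NAME: the narrowed residual ⟹ the support item `AnchoredDoorHitsLowerPairs`.** -/
theorem anchoredDoorHitsLowerPairs_of_ltRestNonCanonRSWPDF (hR : Stmt.stub_ltRestNonCanonRSWPDF) :
    Summit.ValiantsHypothesis.ValiantsHypothesis.Theses.BarrierLever.AnchoredDoorHitsLowerPairs :=
  anchoredDoorHitsLowerPairs_of_ltRestNonCanonRSWPD (stub_ltRestNonCanonRSWPD_of_rswpdf hR)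

end

end Summit.ValiantsHypothesis.ValiantsHypothesis.Theorems.BarrierLever.AnchoredPeeling
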